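import Literature.NumberTheory.LFunctions.ZetaZerosProofs
import Literature.NumberTheory.LFunctions.ZetaZerosReflection
import Literature.NumberTheory.LFunctions.ZetaZerosJensen
import Literature.NumberTheory.LFunctions.ZetaRealAxis
import Literature.NumberTheory.LFunctions.GeneralizedRH
import Literature.NumberTheory.LFunctions.WeilExplicit
import HarnessLib

/-!
# The zero side of the explicit formula as an absolutely convergent sum

Sibling of `Literature/NumberTheory/LFunctions/WeilExplicit.lean` and `ZetaZeros.lean`. The zero
side of the Guinand–Weil explicit formula is the symmetric limit
`lim_T ∑_{ζ(ρ)=0, 0 ≤ Re ρ ≤ 1, 0 < |Im ρ| ≤ T} m(ρ) ĝ(ρ)` (`HasWeilZeroSide`). This file supplies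
what is needed to identify that limit with an absolutely convergent sum over the zero set
(planned discharge of `weil_criterion_zeroSide_converse`, `WeilCriterionProofs.lean`;
E. Bombieri, Rend. Lincei (9) 11 (2000), §2, where absolute convergence "by the rapid decay of
`f̃`" and the zero-counting function are used silently):

* the index set is the tree's set of non-trivial zeros `Literature.NumberTheory.LFunctions.ZetaZeros.riemannZetaNontrivialZeros`
  (`ZetaZeros.lean`); here: `weilZeroIndex T = riemannZetaNontrivialZeros ∩ {|Im ρ| ≤ T}`
  (`weilZeroIndex_eq_inter`, via `mem_riemannZetaNontrivialZeros_iff_holds`,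
  `re_mem_Ioo_of_riemannZeta_eq_zero_of_im_ne_zero` and
  `Literature.NumberTheory.LFunctions.im_ne_zero_of_riemannZeta_eq_zero`), the
  elementary membership API `riemannZetaNontrivialZeros.*` (open strip, `Im ρ ≠ 0`, `m ≥ 1`,
  stability under `ρ ↦ ρ̄` and `ρ ↦ 1 - ρ̄`), countability, local finiteness.
* `weilZeroSummable` (`∑_ρ m(ρ)/(1 + γ²)² < ∞` over the non-trivial zeros, a theorem,
  unconditional):
  for `Re ρ ≥ 1/4` this is dominated by `∑ m(ρ)/|ρ|²`, convergent by
  Jensen's inequality (`Literature.NumberTheory.LFunctions.summable_zeroOrder_div_norm_sq`, `ZetaZerosJensen.lean`;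
  Titchmarsh Thm. 9.2, Montgomery–Vaughan Thm. 10.13), and the zeros with `Re ρ < 1/4` are
  reflected by `ρ ↦ 1 - ρ̄`, which fixes ordinates and multiplicities
  (`riemannZetaZeroOrder_one_sub_conj`, `ZetaZerosReflection.lean`).
* `hasWeilZeroSide_tsum` — if `∑_ρ ‖m(ρ) ĝ(ρ)‖ < ∞` over the non-trivial zeros then
  `HasWeilZeroSide g (∑' ρ, m(ρ) ĝ(ρ))` (the truncations `weilZeroFinset T` are cofinal in
  `Finset riemannZetaNontrivialZeros`); `summable_(norm_)zeroSide_of_le` — the test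
  `‖a(ρ)‖ ≤ K/(1+γ²)²`.

Everything here is proved; there are no named facts.

## References

* E. C. Titchmarsh, *The Theory of the Riemann Zeta-Function*, 2nd ed. (1986), §2.12
  (symmetries of the zeros), §9.2, Thm. 9.2 (`N(T+1) - N(T) = O(log T)` by Jensen's theorem).
* E. Bombieri, *Remarks on Weil's quadratic functional in the theory of prime numbers I*, Rend.
  Lincei (9) 11 (2000), 183–233, §2 (Explicit Formula: the zeros summed symmetrically).
-/

noncomputable section

open Complex Filter Set MeasureTheory
open scoped Real Topology ComplexConjugate

namespace Literature.NumberTheory.LFunctions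

/-! ## The index set of the zero side: the non-trivial zeros -/

namespace ZetaZeros.riemannZetaNontrivialZeros

variable {ρ : ℂ}

/-- Membership in `riemannZetaNontrivialZeros`, unfolded
(`mem_riemannZetaNontrivialZeros_iff_holds`, `ZetaZerosProofs.lean`). [folklore] -/
theorem mem_iff' : ρ ∈ riemannZetaNontrivialZeros ↔ riemannZeta ρ = 0 ∧ 0 < ρ.re ∧ ρ.re < 1 :=
  mem_riemannZetaNontrivialZeros_iff_holds

/-- A zero of `ζ` with `0 < Re ρ` is a non-trivial zero (`riemannZeta_ne_zero_of_one_le_re`).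
[folklore] -/
theorem mem_of_re_pos (hζ : riemannZeta ρ = 0) (h0 : 0 < ρ.re) : ρ ∈ riemannZetaNontrivialZeros :=
  mem_iff'.2 ⟨hζ, h0, LFunctions.re_lt_one_of_riemannZeta_eq_zero hζ⟩

/-- A zero of `ζ` off the real axis is a non-trivial zero
(`re_mem_Ioo_of_riemannZeta_eq_zero_of_im_ne_zero`, `ZetaZerosProofs.lean`). [folklore] -/
theorem mem_of_im_ne_zero (hζ : riemannZeta ρ = 0) (him : ρ.im ≠ 0) :
    ρ ∈ riemannZetaNontrivialZeros :=
  mem_iff'.2 ⟨hζ, re_mem_Ioo_of_riemannZeta_eq_zero_of_im_ne_zero hζ him⟩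

/-- Non-trivial zeros are zeros. [folklore] -/
theorem zeta_eq_zero (h : ρ ∈ riemannZetaNontrivialZeros) : riemannZeta ρ = 0 := (mem_iff'.1 h).1

/-- Non-trivial zeros lie in the open strip. [folklore] -/
theorem re_pos (h : ρ ∈ riemannZetaNontrivialZeros) : 0 < ρ.re := (mem_iff'.1 h).2.1

/-- Non-trivial zeros lie in the open strip. [folklore] -/
theorem re_lt_one (h : ρ ∈ riemannZetaNontrivialZeros) : ρ.re < 1 := (mem_iff'.1 h).2.2

/-- Non-trivial zeros are off the real axis (`ζ(σ) ≠ 0` for real `0 < σ < 1`,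
`Literature.NumberTheory.LFunctions.im_ne_zero_of_riemannZeta_eq_zero`, `ZetaRealAxis.lean`). [folklore] -/
theorem im_ne_zero (h : ρ ∈ riemannZetaNontrivialZeros) : ρ.im ≠ 0 :=
  LFunctions.im_ne_zero_of_riemannZeta_eq_zero (zeta_eq_zero h) (re_pos h) (re_lt_one h)

/-- Non-trivial zeros are `≠ 1`. [folklore] -/
theorem ne_one (h : ρ ∈ riemannZetaNontrivialZeros) : ρ ≠ 1 :=
  LFunctions.ne_one_of_riemannZeta_eq_zero (zeta_eq_zero h)

/-- Multiplicities of non-trivial zeros are `≥ 1`. [folklore] -/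
theorem one_le_order (h : ρ ∈ riemannZetaNontrivialZeros) : 1 ≤ riemannZetaZeroOrder ρ :=
  (riemannZetaZeroOrder_pos_iff (ne_one h)).2 (zeta_eq_zero h)

/-- The non-trivial zeros are stable under `ρ ↦ 1 - ρ̄` (functional equation and conjugation).
[folklore] -/
theorem one_sub_conj_mem (h : ρ ∈ riemannZetaNontrivialZeros) :
    1 - conj ρ ∈ riemannZetaNontrivialZeros := by
  refine mem_iff'.2 ⟨?_, ?_, ?_⟩
  · have h1 : riemannZeta (1 - ρ) = 0 :=
      GeneralizedRH.riemannZeta_one_sub_eq_zero (zeta_eq_zero h) (re_pos h) (re_lt_one h)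
    have : 1 - conj ρ = conj (1 - ρ) := by simp
    rw [this, riemannZeta_conj, h1, map_zero]
  · simp only [sub_re, one_re, conj_re]; linarith [re_lt_one h]
  · simp only [sub_re, one_re, conj_re]; linarith [re_pos h]

/-- The non-trivial zeros are stable under conjugation. [folklore] -/
theorem conj_mem (h : ρ ∈ riemannZetaNontrivialZeros) : conj ρ ∈ riemannZetaNontrivialZeros :=
  mem_iff'.2 ⟨by rw [riemannZeta_conj, zeta_eq_zero h, map_zero], by simpa using re_pos h,
    by simpa using re_lt_one h⟩

end ZetaZeros.riemannZetaNontrivialZeros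

/-- `weilZeroIndex T = riemannZetaNontrivialZeros ∩ {|Im ρ| ≤ T}`: the closed conditions
`0 ≤ Re ρ ≤ 1`, `Im ρ ≠ 0` of `weilZeroIndex` cut out exactly the non-trivial zeros
(`re_mem_Ioo_of_riemannZeta_eq_zero_of_im_ne_zero`, `riemannZetaNontrivialZeros.im_ne_zero`).
[folklore] -/
theorem weilZeroIndex_eq_inter (T : ℝ) :
    weilZeroIndex T = ZetaZeros.riemannZetaNontrivialZeros ∩ {ρ | |ρ.im| ≤ T} := by
  ext ρ
  simp only [weilZeroIndex, mem_setOf_eq, mem_inter_iff]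
  constructor
  · rintro ⟨hζ, -, -, him, hT⟩
    exact ⟨ZetaZeros.riemannZetaNontrivialZeros.mem_of_im_ne_zero hζ him, hT⟩
  · rintro ⟨h, hT⟩
    exact ⟨ZetaZeros.riemannZetaNontrivialZeros.zeta_eq_zero h, (ZetaZeros.riemannZetaNontrivialZeros.re_pos h).le,
      (ZetaZeros.riemannZetaNontrivialZeros.re_lt_one h).le, ZetaZeros.riemannZetaNontrivialZeros.im_ne_zero h, hT⟩

/-- The set of non-trivial zeros is countable (a countable union of the finite sets
`weilZeroIndex n`). [folklore] -/
theorem riemannZetaNontrivialZeros_countable : ZetaZeros.riemannZetaNontrivialZeros.Countable := by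
  have : ZetaZeros.riemannZetaNontrivialZeros = ⋃ n : ℕ, weilZeroIndex n := by
    ext ρ
    simp only [mem_iUnion, weilZeroIndex_eq_inter, mem_inter_iff, mem_setOf_eq]
    constructor
    · intro h
      obtain ⟨n, hn⟩ := exists_nat_ge |ρ.im|
      exact ⟨n, h, hn⟩
    · rintro ⟨n, h, -⟩
      exact h
  rw [this]
  exact countable_iUnion fun n ↦ (weilZeroIndex_finite n).countable

/-- The non-trivial zeros form a countable type (needed to integrate `tsum`s over them
termwise). [folklore] -/
instance : Countable ZetaZeros.riemannZetaNontrivialZeros := riemannZetaNontrivialZeros_countable.to_subtype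

/-- Zeros in a bounded region of the plane are finite in number: the family `ρ ↦ ρ` on the
non-trivial zeros is locally finite. [folklore] -/
theorem riemannZetaNontrivialZeros_finite_inter_ball (z : ℂ) (ε : ℝ) :
    (ZetaZeros.riemannZetaNontrivialZeros ∩ Metric.ball z ε).Finite := by
  refine ((isCompact_closedBall z ε).inter_riemannZetaZeros_finite).subset ?_
  rintro ρ ⟨hρ, hb⟩
  exact ⟨Metric.ball_subset_closedBall hb, ZetaZeros.riemannZetaNontrivialZeros.zeta_eq_zero hρ⟩

/-! ## Summability of `m(ρ)/(1 + γ²)²` over the zeros -/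

/-- The weight `w(ρ) = m(ρ)/(1 + (Im ρ)²)²`. [folklore] -/
def weilZeroWeight (ρ : ℂ) : ℝ :=
  (riemannZetaZeroOrder ρ : ℝ) / (1 + ρ.im ^ 2) ^ 2

/-- The weight is invariant under conjugation (`riemannZetaZeroOrder_conj_holds`). [folklore] -/
theorem weilZeroWeight_conj (ρ : ℂ) : weilZeroWeight (conj ρ) = weilZeroWeight ρ := by
  simp [weilZeroWeight, riemannZetaZeroOrder_conj_holds ρ]

/-- The weight is non-negative on the non-trivial zeros (`m(ρ) ≥ 0` away from the pole).
[folklore] -/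
theorem weilZeroWeight_nonneg {ρ : ℂ} (h : ρ ∈ ZetaZeros.riemannZetaNontrivialZeros) :
    0 ≤ weilZeroWeight ρ :=
  div_nonneg (by exact_mod_cast riemannZetaZeroOrder_nonneg (ZetaZeros.riemannZetaNontrivialZeros.ne_one h))
    (by positivity)

/-- Weight comparison behind `weilZeroSummable`: if `z` has the ordinate and the
multiplicity of a non-trivial zero `ρ` and `(Re z)² ≤ 1`, then `m(ρ)/(1+γ²)² ≤ m(z)/‖z‖²`
(`‖z‖² = (Re z)² + γ² ≤ 1 + γ² ≤ (1 + γ²)²`). Used with `z = ρ` and `z = 1 - ρ̄`. [folklore] -/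
theorem weilZeroWeight_le_div_norm_sq {ρ z : ℂ} (h : ρ ∈ ZetaZeros.riemannZetaNontrivialZeros)
    (him : z.im = ρ.im) (hre : z.re ^ 2 ≤ 1)
    (hm : riemannZetaZeroOrder z = riemannZetaZeroOrder ρ) :
    weilZeroWeight ρ ≤ (riemannZetaZeroOrder z : ℝ) / ‖z‖ ^ 2 := by
  have hm0 : (0 : ℝ) ≤ riemannZetaZeroOrder ρ := by
    exact_mod_cast riemannZetaZeroOrder_nonneg (ZetaZeros.riemannZetaNontrivialZeros.ne_one h)
  have hz : z ≠ 0 := by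
    intro hz
    rw [hz, Complex.zero_im] at him
    exact ZetaZeros.riemannZetaNontrivialZeros.im_ne_zero h him.symm
  have hz2 : 0 < ‖z‖ ^ 2 := by positivity
  rw [weilZeroWeight, hm]
  refine div_le_div_of_nonneg_left hm0 hz2 ?_
  rw [← Complex.normSq_eq_norm_sq, Complex.normSq_apply, him]
  nlinarith [sq_nonneg ρ.im, sq_nonneg (ρ.im ^ 2)]


/-- **Absolute summability of the zero side against `(1 + γ²)^{-2}`** (unconditional):
`∑_{ρ non-trivial} m(ρ)/(1 + γ²)² < ∞`. This is what the zero side of the explicit formula needs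
(test functions have `|ĝ(ρ)| ≪ (1 + γ²)^{-1}` in the strip). The zeros with `Re ρ ≥ 1/4` lie in
`zetaZerosRight`, over which `∑ m(ρ)/|ρ|²` converges by Jensen's inequality
(`Literature.NumberTheory.LFunctions.summable_zeroOrder_div_norm_sq`, `ZetaZerosJensen.lean`; Montgomery–Vaughan Thm. 10.13,
Titchmarsh Thm. 9.2 "`N(T+1) - N(T) = O(log T)`"), and `m(ρ)/(1+γ²)² ≤ m(ρ)/|ρ|²`; the zeros with
`Re ρ < 1/4` are carried into `zetaZerosRight` by the ordinate-preserving reflection `ρ ↦ 1 - ρ̄`,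
which preserves multiplicities (`riemannZetaZeroOrder_one_sub_conj`, from the functional
equation). [cite: Titchmarsh1986, §9.2, Thm. 9.2] -/
theorem weilZeroSummable :
    Summable fun ρ : ZetaZeros.riemannZetaNontrivialZeros ↦ weilZeroWeight (ρ : ℂ) := by
  have hG := summable_zeroOrder_div_norm_sq
  have hζ : ∀ ρ : ZetaZeros.riemannZetaNontrivialZeros, riemannZeta ρ = 0 := fun ρ ↦
    ZetaZeros.riemannZetaNontrivialZeros.zeta_eq_zero ρ.2
  set s : Set ZetaZeros.riemannZetaNontrivialZeros := {ρ | 1 / 4 ≤ (ρ : ℂ).re} with hs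
  refine (summable_subtype_and_compl (s := s)).1 ⟨?_, ?_⟩
  · -- zeros with `Re ρ ≥ 1/4`: inclusion into `zetaZerosRight`
    let i₁ : s → zetaZerosRight := fun ρ ↦
      ⟨((ρ : ZetaZeros.riemannZetaNontrivialZeros) : ℂ), hζ (ρ : ZetaZeros.riemannZetaNontrivialZeros), ρ.2⟩
    have hi₁ : Function.Injective i₁ := by
      intro a b hab
      have h := congrArg Subtype.val hab
      exact Subtype.ext (Subtype.ext h)
    refine Summable.of_nonneg_of_le
      (fun ρ ↦ weilZeroWeight_nonneg (ρ : ZetaZeros.riemannZetaNontrivialZeros).2) (fun ρ ↦ ?_)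
      (hG.comp_injective hi₁)
    have h1 : ((ρ : ZetaZeros.riemannZetaNontrivialZeros) : ℂ).re ^ 2 ≤ 1 := by
      have h0 := ZetaZeros.riemannZetaNontrivialZeros.re_pos (ρ : ZetaZeros.riemannZetaNontrivialZeros).2
      have h1 := ZetaZeros.riemannZetaNontrivialZeros.re_lt_one (ρ : ZetaZeros.riemannZetaNontrivialZeros).2
      nlinarith
    exact weilZeroWeight_le_div_norm_sq (ρ : ZetaZeros.riemannZetaNontrivialZeros).2 rfl h1 rfl
  · -- zeros with `Re ρ < 1/4`: reflection `ρ ↦ 1 - ρ̄` into `zetaZerosRight`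
    have hmem : ∀ ρ : ↥sᶜ, riemannZeta (1 - conj ((ρ : ZetaZeros.riemannZetaNontrivialZeros) : ℂ)) = 0 ∧
        1 / 4 ≤ (1 - conj ((ρ : ZetaZeros.riemannZetaNontrivialZeros) : ℂ)).re := by
      intro ρ
      have hρ := (ρ : ZetaZeros.riemannZetaNontrivialZeros).2
      have hlt : ¬ 1 / 4 ≤ ((ρ : ZetaZeros.riemannZetaNontrivialZeros) : ℂ).re := ρ.2
      refine ⟨ZetaZeros.riemannZetaNontrivialZeros.zeta_eq_zero
        (ZetaZeros.riemannZetaNontrivialZeros.one_sub_conj_mem hρ), ?_⟩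
      simp only [sub_re, one_re, conj_re]
      linarith
    let i₂ : ↥sᶜ → zetaZerosRight := fun ρ ↦
      ⟨1 - conj ((ρ : ZetaZeros.riemannZetaNontrivialZeros) : ℂ), hmem ρ⟩
    have hi₂ : Function.Injective i₂ := by
      intro a b hab
      have h : 1 - conj ((a : ZetaZeros.riemannZetaNontrivialZeros) : ℂ) =
          1 - conj ((b : ZetaZeros.riemannZetaNontrivialZeros) : ℂ) := by
        have := congrArg Subtype.val hab
        exact this
      have h' :
          ((a : ZetaZeros.riemannZetaNontrivialZeros) : ℂ) = ((b : ZetaZeros.riemannZetaNontrivialZeros) : ℂ) := by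
        have := congrArg conj (sub_right_injective h)
        simpa using this
      exact Subtype.ext (Subtype.ext h')
    refine Summable.of_nonneg_of_le
      (fun ρ ↦ weilZeroWeight_nonneg (ρ : ZetaZeros.riemannZetaNontrivialZeros).2) (fun ρ ↦ ?_)
      (hG.comp_injective hi₂)
    have hρ := (ρ : ZetaZeros.riemannZetaNontrivialZeros).2
    have h0 := ZetaZeros.riemannZetaNontrivialZeros.re_pos hρ
    have h1 := ZetaZeros.riemannZetaNontrivialZeros.re_lt_one hρ
    refine weilZeroWeight_le_div_norm_sq hρ (by simp [i₂]) ?_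
      (riemannZetaZeroOrder_one_sub_conj h0 h1)
    simp only [i₂, sub_re, one_re, conj_re]
    nlinarith

/-! ## The zero side as an absolutely convergent sum -/

/-- The truncation `weilZeroIndex T`, seen inside the subtype `riemannZetaNontrivialZeros`, as a
`Finset`. [folklore] -/
def weilZeroFinset (T : ℝ) : Finset ZetaZeros.riemannZetaNontrivialZeros :=
  ((weilZeroIndex_finite T).preimage Subtype.val_injective.injOn).toFinset

/-- Membership in `weilZeroFinset T` is `|Im ρ| ≤ T`. [folklore] -/
theorem mem_weilZeroFinset {T : ℝ} {ρ : ZetaZeros.riemannZetaNontrivialZeros} :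
    ρ ∈ weilZeroFinset T ↔ |(ρ : ℂ).im| ≤ T := by
  simp only [weilZeroFinset, Set.Finite.mem_toFinset, mem_preimage, weilZeroIndex_eq_inter,
    mem_inter_iff, mem_setOf_eq, Subtype.coe_prop, true_and]

/-- The truncations exhaust: `weilZeroFinset T → atTop` in `Finset riemannZetaNontrivialZeros`.
[folklore] -/
theorem tendsto_weilZeroFinset : Tendsto weilZeroFinset atTop atTop := by
  refine tendsto_atTop.2 fun s ↦ ?_
  filter_upwards [eventually_ge_atTop (∑ ρ ∈ s, |(ρ : ℂ).im|)] with T hT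
  intro ρ hρ
  rw [mem_weilZeroFinset]
  exact (Finset.single_le_sum (fun ρ _ ↦ abs_nonneg _) hρ).trans hT

/-- The truncated zero side is the `Finset` sum over `weilZeroFinset T`. [folklore] -/
theorem weilZeroSidePartial_eq_sum (g : ℝ → ℂ) (T : ℝ) :
    weilZeroSidePartial g T =
      ∑ ρ ∈ weilZeroFinset T, (riemannZetaZeroOrder (ρ : ℂ) : ℂ) * weilMellin g ρ := by
  classical
  have e : ∑ ρ ∈ weilZeroFinset T, (riemannZetaZeroOrder (ρ : ℂ) : ℂ) * weilMellin g ρ =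
      ∑ z ∈ (weilZeroFinset T).map (Function.Embedding.subtype _),
        (riemannZetaZeroOrder z : ℂ) * weilMellin g z := by
    rw [Finset.sum_map]
    rfl
  rw [e, weilZeroSidePartial, finsum_mem_eq_finite_toFinset_sum _ (weilZeroIndex_finite T)]
  refine Finset.sum_congr ?_ fun _ _ ↦ rfl
  ext z
  simp only [Set.Finite.mem_toFinset, Finset.mem_map, Function.Embedding.subtype_apply]
  constructor
  · intro hz
    have hz' : z ∈ ZetaZeros.riemannZetaNontrivialZeros := by rw [weilZeroIndex_eq_inter] at hz; exact hz.1
    refine ⟨⟨z, hz'⟩, ?_, rfl⟩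
    rw [mem_weilZeroFinset]
    rw [weilZeroIndex_eq_inter] at hz
    exact hz.2
  · rintro ⟨ρ, hρ, rfl⟩
    rw [weilZeroIndex_eq_inter]
    exact ⟨ρ.2, mem_weilZeroFinset.1 hρ⟩

/-- **The zero side converges absolutely when it converges absolutely termwise**: if
`∑_{ρ non-trivial} ‖m(ρ) ĝ(ρ)‖ < ∞` then the symmetric truncations converge to the sum,
`HasWeilZeroSide g (∑' ρ, m(ρ) ĝ(ρ))`. [folklore] -/
theorem hasWeilZeroSide_tsum {g : ℝ → ℂ}
    (hg : Summable fun ρ : ZetaZeros.riemannZetaNontrivialZeros ↦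
      ‖(riemannZetaZeroOrder (ρ : ℂ) : ℂ) * weilMellin g ρ‖) :
    HasWeilZeroSide g
      (∑' ρ : ZetaZeros.riemannZetaNontrivialZeros, (riemannZetaZeroOrder (ρ : ℂ) : ℂ) * weilMellin g ρ) := by
  unfold HasWeilZeroSide
  have h := hg.of_norm.hasSum.comp tendsto_weilZeroFinset
  refine h.congr fun T ↦ ?_
  simp only [Function.comp_apply, weilZeroSidePartial_eq_sum]

/-- Summability test, norm form: if `‖a(ρ)‖ ≤ K/(1 + (Im ρ)²)²` on the non-trivial zeros then
`∑ ‖m(ρ) a(ρ)‖ < ∞` (`weilZeroSummable`). [folklore] -/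
theorem summable_norm_zeroSide_of_le {a : ℂ → ℂ} {K : ℝ}
    (ha : ∀ ρ ∈ ZetaZeros.riemannZetaNontrivialZeros, ‖a ρ‖ ≤ K / (1 + ρ.im ^ 2) ^ 2) :
    Summable fun ρ : ZetaZeros.riemannZetaNontrivialZeros ↦ ‖(riemannZetaZeroOrder (ρ : ℂ) : ℂ) * a ρ‖ := by
  refine Summable.of_nonneg_of_le (fun _ ↦ norm_nonneg _) (fun ρ ↦ ?_)
    (weilZeroSummable.mul_left K)
  have hm : (0 : ℝ) ≤ riemannZetaZeroOrder (ρ : ℂ) := by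
    exact_mod_cast riemannZetaZeroOrder_nonneg (ZetaZeros.riemannZetaNontrivialZeros.ne_one ρ.2)
  rw [norm_mul, Complex.norm_intCast, abs_of_nonneg hm, weilZeroWeight]
  calc (riemannZetaZeroOrder (ρ : ℂ) : ℝ) * ‖a ρ‖
      ≤ (riemannZetaZeroOrder (ρ : ℂ) : ℝ) * (K / (1 + (ρ : ℂ).im ^ 2) ^ 2) :=
        mul_le_mul_of_nonneg_left (ha ρ ρ.2) hm
    _ = K * ((riemannZetaZeroOrder (ρ : ℂ) : ℝ) / (1 + (ρ : ℂ).im ^ 2) ^ 2) := by ring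

/-- Summability test: if `‖a(ρ)‖ ≤ K/(1 + (Im ρ)²)²` on the non-trivial zeros then `∑ m(ρ) a(ρ)`
converges absolutely (`weilZeroSummable`). [folklore] -/
theorem summable_zeroSide_of_le {a : ℂ → ℂ} {K : ℝ}
    (ha : ∀ ρ ∈ ZetaZeros.riemannZetaNontrivialZeros, ‖a ρ‖ ≤ K / (1 + ρ.im ^ 2) ^ 2) :
    Summable fun ρ : ZetaZeros.riemannZetaNontrivialZeros ↦ (riemannZetaZeroOrder (ρ : ℂ) : ℂ) * a ρ :=
  (summable_norm_zeroSide_of_le ha).of_norm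

end Literature.NumberTheory.LFunctions

end
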